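import Summits.ABC.ABC.Theorems.FeketeScalesTargetCalibration

/-!
# Route FeketeScales — crux `Target` (stmt-ABC-2159): Legendre duality and effective good scales

First of three files pinning down the EFFECTIVE form of the route's thesis (line lead of
`Cruxes/Target/`, line `SketchIdeator2`; `--supports stmt-ABC-2159`, closes nothing).  Every line of
the crux passes through the POINTWISE SUB-POWER SLACK
`SPS := ∃ τ < 1, ∃ A, ∀ abc triples, c < rad · exp(A (log rad)^τ)` (`Target.target_of_subPowerSlack`).

* `Target.polyConstant_of_subPowerSlack` — the converse of `Target.subPowerSlack_of_polyConstant`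
  (`FeketeScalesTargetCalibration.lean`): SPS ⟺ abc with a quasi-polynomial constant
  `c ≤ exp(A ε^{-κ}) rad^{1+ε}` for `0 < ε ≤ 1` (`calib_polyConstant_iff_subPowerSlack`, a registered calibration sub-goal of the line).
* `Target.effectiveGoodScales_of_polyConstant` — a quasi-polynomial constant makes EVERY scale
  `R ≥ exp(C δ^{-B})` `δ`-good, i.e. `c ≤ R^{1+δ}` for all abc triples with `rad ≤ R`
  ("effective good scales"); in particular `SparseGoodScales`
  (`Target.sparseGoodScales_of_effectiveGoodScales`).
* `TargetEff.rpow_le_linear_add_rpow` — sublinearity of `y ↦ y^φ` with the explicit intercept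
  `a^{-φ/(1-φ)}` (explicit form of `FeketeScalesAssembly.rpow_le_linear_add_const`), the tool that
  makes the Fekete iteration of the Assembly effective in `FeketeScalesTargetEffectiveFekete.lean`.

Elementary real analysis; Mathlib only; no new definitions (statements inlined in the tree's
vocabulary `IsABCTriple`/`rad`).
-/

-- `Summit.<Summit>.<Problem>` is the mandated summit-side namespace (CONVENTIONS §2); for the
-- single-conjunct summit `ABC` the two coincide, so the duplicate `ABC.ABC` is deliberate.
set_option linter.dupNamespace false

namespace Summit.ABC.ABC.Theorems

open Literature.NumberTheory.DiophantineGeometry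
open Summit.ABC.ABC.Theses.FeketeScales

/-- Sublinearity of `y ↦ y ^ φ` (`0 ≤ φ < 1`) with an EXPLICIT intercept: for every slope `a > 0`,
`y ^ φ ≤ a y + a ^ (-(φ/(1-φ)))` for all `y ≥ 0` (threshold `M = a^{1/(φ-1)}`: above it
`y^φ = y^{φ-1} y ≤ a y`, below it `y^φ ≤ M^φ = a^{-φ/(1-φ)}`).  Explicit form of
`FeketeScalesAssembly.rpow_le_linear_add_const`. [folklore] -/
theorem TargetEff.rpow_le_linear_add_rpow {φ a : ℝ} (hφ0 : 0 ≤ φ) (hφ1 : φ < 1) (ha : 0 < a)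
    {y : ℝ} (hy : 0 ≤ y) : y ^ φ ≤ a * y + a ^ (-(φ / (1 - φ))) := by
  have hne : φ - 1 ≠ 0 := by linarith
  set M : ℝ := a ^ (φ - 1)⁻¹ with hM
  have hMpos : 0 < M := Real.rpow_pos_of_pos ha _
  have hMa : M ^ (φ - 1) = a := by rw [hM, Real.rpow_inv_rpow ha.le hne]
  have hne' : 1 - φ ≠ 0 := by
    intro h0; apply hne; linarith
  have hMφ : M ^ φ = a ^ (-(φ / (1 - φ))) := by
    rw [hM, ← Real.rpow_mul ha.le]
    congr 1
    field_simp
    ring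
  have hint0 : 0 ≤ a ^ (-(φ / (1 - φ))) := Real.rpow_nonneg ha.le _
  rcases le_or_gt y M with hyM | hyM
  · have h1 : y ^ φ ≤ M ^ φ := Real.rpow_le_rpow hy hyM hφ0
    have h2 : 0 ≤ a * y := mul_nonneg ha.le hy
    rw [hMφ] at h1
    linarith
  · have hypos : 0 < y := hMpos.trans hyM
    have h1 : y ^ φ = y ^ (φ - 1) * y := by
      have := Real.rpow_add hypos (φ - 1) 1
      rw [Real.rpow_one] at this
      rw [← this]; ring_nf
    have h2 : y ^ (φ - 1) ≤ M ^ (φ - 1) :=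
      Real.rpow_le_rpow_of_nonpos hMpos hyM.le (by linarith)
    rw [hMa] at h2
    have h3 : y ^ (φ - 1) * y ≤ a * y := mul_le_mul_of_nonneg_right h2 hy
    rw [h1]
    linarith

/-- Monotonicity of negative powers of a number in `(0, 1]`: `δ^{-e} ≤ δ^{-E}` for `e ≤ E`.
[folklore] -/
theorem TargetEff.rpow_neg_le_rpow_neg {δ e E : ℝ} (hδ0 : 0 < δ) (hδ1 : δ ≤ 1) (heE : e ≤ E) :
    δ ^ (-e) ≤ δ ^ (-E) :=
  Real.rpow_le_rpow_of_exponent_ge hδ0 hδ1 (by linarith)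

/-- `1 ≤ δ^{-e}` for `δ ∈ (0, 1]` and `e ≥ 0`. [folklore] -/
theorem TargetEff.one_le_rpow_neg {δ e : ℝ} (hδ0 : 0 < δ) (hδ1 : δ ≤ 1) (he : 0 ≤ e) :
    1 ≤ δ ^ (-e) :=
  Real.one_le_rpow_of_pos_of_le_one_of_nonpos hδ0 hδ1 (by linarith)

/-- **Legendre duality, converse direction.**  The pointwise sub-power slack
`∃ τ < 1, ∃ A, c < rad · exp(A (log rad)^τ)` implies abc with a quasi-polynomial constant,
`∃ κ A', ∀ 0 < ε ≤ 1, c ≤ exp(A' ε^{-κ}) rad^{1+ε}`, with `κ = t/(1-t)`, `t = max τ 0`: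
by `SubmultOfRST.slack_le`, `A (log rad)^τ ≤ B (log rad)^t` with `B = |A| max(1,(log 2)^τ)`, and
by sublinearity with slope `ε/(B+1)` (`TargetEff.rpow_le_linear_add_rpow`),
`(B+1) L^t ≤ ε L + (B+1)(ε/(B+1))^{-κ} = ε L + (B+1)^{1+κ} ε^{-κ}`.  Converse of
`Target.subPowerSlack_of_polyConstant`. [folklore] -/
theorem Target.polyConstant_of_subPowerSlack
    (h : ∃ τ : ℝ, τ < 1 ∧ ∃ A : ℝ, ∀ a b c : ℕ, IsABCTriple a b c →
      (c : ℝ) < ((rad a b c : ℕ) : ℝ) * Real.exp (A * Real.log ((rad a b c : ℕ) : ℝ) ^ τ)) :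
    ∃ κ A : ℝ, ∀ ε : ℝ, 0 < ε → ε ≤ 1 → ∀ a b c : ℕ, IsABCTriple a b c →
      (c : ℝ) ≤ Real.exp (A * ε ^ (-κ)) * ((rad a b c : ℕ) : ℝ) ^ (1 + ε) := by
  obtain ⟨τ, hτ1, A, h⟩ := h
  set t : ℝ := max τ 0 with ht_def
  have ht0 : 0 ≤ t := le_max_right _ _
  have ht1 : t < 1 := max_lt hτ1 one_pos
  set B : ℝ := |A| * max 1 (Real.log 2 ^ τ) with hB_def
  have hB0 : 0 ≤ B := mul_nonneg (abs_nonneg A) (le_trans zero_le_one (le_max_left _ _))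
  have hB1 : 0 < B + 1 := by linarith
  set κ : ℝ := t / (1 - t) with hκ_def
  have hκ0 : 0 ≤ κ := div_nonneg ht0 (by linarith)
  refine ⟨κ, (B + 1) * (B + 1) ^ κ, ?_⟩
  intro ε hε hε1 a b c habc
  have hrad2 : (2 : ℝ) ≤ ((rad a b c : ℕ) : ℝ) := by exact_mod_cast SubmultOfRST.two_le_rad habc
  have hrad0 : (0 : ℝ) < ((rad a b c : ℕ) : ℝ) := by linarith
  set L : ℝ := Real.log ((rad a b c : ℕ) : ℝ) with hL_def
  have hL0 : 0 < L := Real.log_pos (by linarith)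
  -- step 1: `A L^τ ≤ B L^t`
  have h1 : A * L ^ τ ≤ B * L ^ t := by
    have := SubmultOfRST.slack_le (τ := τ) (A := A) habc le_rfl
    simpa [hB_def, ht_def, hL_def] using this
  -- step 2: sublinearity with slope `ε/(B+1)`
  have hslope : 0 < ε / (B + 1) := div_pos hε hB1
  have h2 : L ^ t ≤ ε / (B + 1) * L + (ε / (B + 1)) ^ (-κ) := by
    have := TargetEff.rpow_le_linear_add_rpow ht0 ht1 hslope hL0.le
    simpa [hκ_def] using this
  have hpow : (ε / (B + 1)) ^ (-κ) = ε ^ (-κ) * (B + 1) ^ κ := by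
    rw [Real.div_rpow hε.le hB1.le, Real.rpow_neg hB1.le, div_inv_eq_mul]
  have h3 : B * L ^ t ≤ ε * L + (B + 1) * (B + 1) ^ κ * ε ^ (-κ) := by
    have hLt0 : 0 ≤ L ^ t := Real.rpow_nonneg hL0.le _
    have hBB : B * L ^ t ≤ (B + 1) * L ^ t := by nlinarith
    have := mul_le_mul_of_nonneg_left h2 hB1.le
    rw [hpow] at this
    have e1 : (B + 1) * (ε / (B + 1) * L + ε ^ (-κ) * (B + 1) ^ κ)
        = ε * L + (B + 1) * (B + 1) ^ κ * ε ^ (-κ) := by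
      field_simp
    linarith
  -- step 3: assemble
  have hexpL : Real.exp (ε * L) = ((rad a b c : ℕ) : ℝ) ^ ε := by
    rw [Real.rpow_def_of_pos hrad0, hL_def, mul_comm]
  have hsplit : ((rad a b c : ℕ) : ℝ) ^ (1 + ε) = ((rad a b c : ℕ) : ℝ) * ((rad a b c : ℕ) : ℝ) ^ ε := by
    rw [Real.rpow_add hrad0, Real.rpow_one]
  calc (c : ℝ) ≤ ((rad a b c : ℕ) : ℝ) * Real.exp (A * L ^ τ) := (h a b c habc).le
    _ ≤ ((rad a b c : ℕ) : ℝ) * Real.exp (ε * L + (B + 1) * (B + 1) ^ κ * ε ^ (-κ)) := by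
        apply mul_le_mul_of_nonneg_left _ hrad0.le
        exact Real.exp_le_exp.mpr (h1.trans h3)
    _ = Real.exp ((B + 1) * (B + 1) ^ κ * ε ^ (-κ)) * ((rad a b c : ℕ) : ℝ) ^ (1 + ε) := by
        rw [Real.exp_add, hexpL, hsplit]; ring

/-- **The two normal forms of the "sub-power" strengthening of abc coincide**: abc with a
quasi-polynomial constant `exp(A ε^{-κ})` ⟺ the pointwise sub-power slack
(`Target.subPowerSlack_of_polyConstant` and `Target.polyConstant_of_subPowerSlack`).  Registered
calibration sub-goal of line `SketchIdeator2` (stated fully qualified, on one line). [folklore] -/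
theorem calib_polyConstant_iff_subPowerSlack : (∃ κ A : ℝ, ∀ ε : ℝ, 0 < ε → ε ≤ 1 → ∀ a b c : ℕ, Literature.NumberTheory.DiophantineGeometry.IsABCTriple a b c → (c : ℝ) ≤ Real.exp (A * ε ^ (-κ)) * ((Literature.NumberTheory.DiophantineGeometry.rad a b c : ℕ) : ℝ) ^ (1 + ε)) ↔ (∃ τ : ℝ, τ < 1 ∧ ∃ A : ℝ, ∀ a b c : ℕ, Literature.NumberTheory.DiophantineGeometry.IsABCTriple a b c → (c : ℝ) < ((Literature.NumberTheory.DiophantineGeometry.rad a b c : ℕ) : ℝ) * Real.exp (A * Real.log ((Literature.NumberTheory.DiophantineGeometry.rad a b c : ℕ) : ℝ) ^ τ)) :=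
  ⟨Target.subPowerSlack_of_polyConstant, Target.polyConstant_of_subPowerSlack⟩

/-- **Effective good scales from a quasi-polynomial constant.**  If
`c ≤ exp(A ε^{-κ}) rad^{1+ε}` for all `0 < ε ≤ 1`, then with `k = max κ 0`,
`B = 1 + k` and `C = 2^{1+k} |A|` EVERY scale `R ≥ exp(C δ^{-B})` is `δ`-good (`0 < δ ≤ 1`):
for a triple with `rad ≤ R`, `c ≤ exp(A (δ/2)^{-κ}) R^{1+δ/2}` and
`A (δ/2)^{-κ} ≤ |A| 2^k δ^{-k} ≤ (δ/2) C δ^{-B} ≤ (δ/2) log R`. [folklore] -/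
theorem Target.effectiveGoodScales_of_polyConstant
    (h : ∃ κ A : ℝ, ∀ ε : ℝ, 0 < ε → ε ≤ 1 → ∀ a b c : ℕ, IsABCTriple a b c →
      (c : ℝ) ≤ Real.exp (A * ε ^ (-κ)) * ((rad a b c : ℕ) : ℝ) ^ (1 + ε)) :
    ∃ B C : ℝ, ∀ δ : ℝ, 0 < δ → δ ≤ 1 → ∀ R : ℕ, Real.exp (C * δ ^ (-B)) ≤ (R : ℝ) →
      ∀ a b c : ℕ, IsABCTriple a b c → rad a b c ≤ R → (c : ℝ) ≤ (R : ℝ) ^ (1 + δ) := by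
  obtain ⟨κ, A, h⟩ := h
  set k : ℝ := max κ 0 with hk_def
  have hk0 : 0 ≤ k := le_max_right _ _
  have hκk : κ ≤ k := le_max_left _ _
  refine ⟨1 + k, 2 ^ (1 + k) * |A|, ?_⟩
  intro δ hδ hδ1 R hR a b c habc hrad
  have h2k : 0 < (2 : ℝ) ^ (1 + k) := by positivity
  have hexp0 : 0 < Real.exp (2 ^ (1 + k) * |A| * δ ^ (-(1 + k))) := Real.exp_pos _
  have hR0 : (0 : ℝ) < R := hexp0.trans_le hR
  have hR1 : (1 : ℝ) ≤ R := by
    have : (1 : ℝ) ≤ Real.exp (2 ^ (1 + k) * |A| * δ ^ (-(1 + k))) := by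
      rw [Real.one_le_exp_iff]
      exact mul_nonneg (mul_nonneg h2k.le (abs_nonneg A)) (Real.rpow_nonneg hδ.le _)
    exact this.trans hR
  have hlogR0 : 0 ≤ Real.log R := Real.log_nonneg hR1
  have hrad0 : (0 : ℝ) ≤ ((rad a b c : ℕ) : ℝ) := Nat.cast_nonneg _
  have hradR : ((rad a b c : ℕ) : ℝ) ≤ R := by exact_mod_cast hrad
  have hε : 0 < δ / 2 := by linarith
  have hε1 : δ / 2 ≤ 1 := by linarith
  have h1 := h (δ / 2) hε hε1 a b c habc
  -- the exponent bound `A (δ/2)^{-κ} ≤ (δ/2) log R`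
  have hhalf0 : 0 < δ / 2 := hε
  have hhalf1 : δ / 2 ≤ 1 := hε1
  have hpow1 : (δ / 2) ^ (-κ) ≤ (δ / 2) ^ (-k) :=
    TargetEff.rpow_neg_le_rpow_neg hhalf0 hhalf1 hκk
  have hpow2 : (δ / 2) ^ (-k) = 2 ^ k * δ ^ (-k) := by
    rw [Real.div_rpow hδ.le (by norm_num : (0:ℝ) ≤ 2), Real.rpow_neg (by norm_num : (0:ℝ) ≤ 2)]
    field_simp
  have hAk : A * (δ / 2) ^ (-κ) ≤ |A| * (2 ^ k * δ ^ (-k)) := by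
    calc A * (δ / 2) ^ (-κ) ≤ |A| * (δ / 2) ^ (-κ) :=
          mul_le_mul_of_nonneg_right (le_abs_self A) (Real.rpow_nonneg hhalf0.le _)
      _ ≤ |A| * (δ / 2) ^ (-k) := mul_le_mul_of_nonneg_left hpow1 (abs_nonneg A)
      _ = |A| * (2 ^ k * δ ^ (-k)) := by rw [hpow2]
  -- `|A| 2^k δ^{-k} = (δ/2) (2^{1+k} |A| δ^{-(1+k)})`
  have hkey : |A| * (2 ^ k * δ ^ (-k)) = δ / 2 * (2 ^ (1 + k) * |A| * δ ^ (-(1 + k))) := by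
    have e1 : (2:ℝ) ^ (1 + k) = 2 * 2 ^ k := by
      rw [Real.rpow_add (by norm_num : (0:ℝ) < 2), Real.rpow_one]
    have e2 : δ ^ (-(1 + k)) = δ⁻¹ * δ ^ (-k) := by
      rw [show -(1 + k) = -1 + -k by ring, Real.rpow_add hδ, Real.rpow_neg_one]
    rw [e1, e2]
    field_simp
  have hlogR : 2 ^ (1 + k) * |A| * δ ^ (-(1 + k)) ≤ Real.log R := by
    have := Real.log_le_log hexp0 hR
    rwa [Real.log_exp] at this
  have hexpo : A * (δ / 2) ^ (-κ) ≤ δ / 2 * Real.log R := by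
    calc A * (δ / 2) ^ (-κ) ≤ |A| * (2 ^ k * δ ^ (-k)) := hAk
      _ = δ / 2 * (2 ^ (1 + k) * |A| * δ ^ (-(1 + k))) := hkey
      _ ≤ δ / 2 * Real.log R := mul_le_mul_of_nonneg_left hlogR hε.le
  have hC : Real.exp (A * (δ / 2) ^ (-κ)) ≤ (R : ℝ) ^ (δ / 2) := by
    calc Real.exp (A * (δ / 2) ^ (-κ)) ≤ Real.exp (δ / 2 * Real.log R) := Real.exp_le_exp.mpr hexpo
      _ = (R : ℝ) ^ (δ / 2) := by rw [Real.rpow_def_of_pos hR0, mul_comm]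
  calc (c : ℝ) ≤ Real.exp (A * (δ / 2) ^ (-κ)) * ((rad a b c : ℕ) : ℝ) ^ (1 + δ / 2) := h1
    _ ≤ Real.exp (A * (δ / 2) ^ (-κ)) * (R : ℝ) ^ (1 + δ / 2) :=
        mul_le_mul_of_nonneg_left (Real.rpow_le_rpow hrad0 hradR (by linarith)) (Real.exp_pos _).le
    _ ≤ (R : ℝ) ^ (δ / 2) * (R : ℝ) ^ (1 + δ / 2) :=
        mul_le_mul_of_nonneg_right hC (Real.rpow_nonneg hR0.le _)
    _ = (R : ℝ) ^ (1 + δ) := by rw [← Real.rpow_add hR0]; ring_nf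

/-- Effective good scales are, in particular, sparse good scales (`SparseGoodScales`): given `δ`
(WLOG `δ ≤ 1`, smaller exponents being harder) and `N`, the scale `max N ⌈exp(C δ'^{-B})⌉` is good.
[folklore] -/
theorem Target.sparseGoodScales_of_effectiveGoodScales
    (h : ∃ B C : ℝ, ∀ δ : ℝ, 0 < δ → δ ≤ 1 → ∀ R : ℕ, Real.exp (C * δ ^ (-B)) ≤ (R : ℝ) →
      ∀ a b c : ℕ, IsABCTriple a b c → rad a b c ≤ R → (c : ℝ) ≤ (R : ℝ) ^ (1 + δ)) :
    SparseGoodScales := by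
  obtain ⟨B, C, h⟩ := h
  unfold SparseGoodScales
  intro δ hδ N
  set δ' : ℝ := min δ 1 with hδ'
  have hδ'0 : 0 < δ' := lt_min hδ one_pos
  have hδ'1 : δ' ≤ 1 := min_le_right _ _
  have hδ'δ : δ' ≤ δ := min_le_left _ _
  set R : ℕ := max (max N 1) ⌈Real.exp (C * δ' ^ (-B))⌉₊ with hR
  refine ⟨R, (le_max_left _ _).trans (le_max_left _ _), ?_⟩
  intro a b c habc hrad
  have hRexp : Real.exp (C * δ' ^ (-B)) ≤ (R : ℝ) :=
    (Nat.le_ceil _).trans (by exact_mod_cast le_max_right _ _)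
  have hR1 : (1 : ℝ) ≤ R := by exact_mod_cast (le_max_right _ _).trans (le_max_left _ _)
  calc (c : ℝ) ≤ (R : ℝ) ^ (1 + δ') := h δ' hδ'0 hδ'1 R hRexp a b c habc hrad
    _ ≤ (R : ℝ) ^ (1 + δ) := Real.rpow_le_rpow_of_exponent_le hR1 (by linarith)


end Summit.ABC.ABC.Theorems
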